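import Summits.ValiantsHypothesis.ValiantsHypothesis.Theorems.LacunarySymmetroidMatrixDescartesCensusLP34Box13
import Summits.ValiantsHypothesis.ValiantsHypothesis.Theorems.LacunarySymmetroidMatrixDescartesCensusDoorA34Letters

/-!
# `MatrixDescartes` census — DOOR A at `(3,4)`: BOX12 COSTS EXACTLY THE ALL-INDEFINITE ROWS ON TWELVE SUPPORTS

HONEST FRAMING.  Object-search cell `pub-symmetroid`; beside the OPEN typed statement `DoorA34 = PosRootLawAt 3 4 18`
(route item `Theses.LacunarySymmetroid.DoorA34`, stmt-ValiantsHypothesis-19980), asserted nowhere.  Bookkeeping of the LOCATED OPEN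
CORE of Door A at `(3,4)` on the first residue window: on the window of width `12` the tree already holds
(i) the Descartes layer (repeated exponents, non-Sidon supports: `doorA34_on_of_not_injective`, `doorA34_on_of_card_tripleSums_le`),
(ii) the SINGULAR-LETTER sector (`doorA34_on_singular_letter`: a letter with `det = 0` kills the cube monomial, `V ≤ 18`), and
(iii) the DEFINITE-LETTER sector (`doorA34_box12_of_definite_letter`: engine-2's LP34 certificates replayed in `…CensusLP34On<tag>`,
all fifteen definite words dead on the twelve 3-Sidon supports with `d₃ ≤ 12`).  What is left is the ALL-INDEFINITE WORD `IIII`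
(four nonsingular indefinite letters) on those twelve supports (six mirror pairs
`(0,1,7,11)/(0,4,10,11)`, `(0,1,8,11)/(0,3,10,11)`, `(0,1,5,12)/(0,7,11,12)`, `(0,3,7,12)/(0,5,9,12)`, `(0,1,9,12)/(0,3,11,12)`,
`(0,2,9,12)/(0,3,10,12)`), for which the cell has NO certificate instrument.  This file records exactly that cost:

* `doorA34_on_of_sectors` — on ANY support, the row `ζ(3,4; d) ≤ 18` follows from the definite-letter row and the all-indefinite row
  on `d` (the singular sector is free);
* `doorA34_box12_of_allIndefinite_rows` — **BOX12 ⟸ the twelve `IIII` rows**: if on each of the twelve sorted 3-Sidon supports of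
  width `≤ 12` every real symmetric pencil with four NONSINGULAR INDEFINITE letters has at most `18` distinct positive det-roots, then
  `PosRootLawOn 3 4 18 d` holds for every exponent vector `d` in a window of width `12`.

Nothing here proves any `IIII` row; `DoorA34` stays OPEN; nothing bears on `MatrixDescartes` (stmt-ValiantsHypothesis-18050) or on
`VP ≠ VNP`.  [folklore] Assembly; elementary.
-/

-- `Summit.ValiantsHypothesis.ValiantsHypothesis.…` repeats a component by the D-0017 layout
-- (single-conjunct summit), which the `dupNamespace` linter flags; the name is mandated.
set_option linter.dupNamespace false

namespace Summit.ValiantsHypothesis.ValiantsHypothesis.Theorems.LacunarySymmetroidMatrixDescartes.Census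

open Polynomial Finset
open scoped BigOperators Polynomial Matrix

/-- **Sector split on one support.**  On any exponent vector `d`, the Door-A row for real symmetric `3 × 3` pencils follows from
the row for pencils with a DEFINITE letter together with the row for pencils with four NONSINGULAR INDEFINITE letters — a singular
letter is the tree's `doorA34_on_singular_letter`. [folklore] -/
theorem doorA34_on_of_sectors (d : Fin 4 → ℕ)
    (hdefrow : ∀ S : Fin 4 → Matrix (Fin 3) (Fin 3) ℝ, (∀ l, (S l).IsSymm) → (∃ l, (S l).PosDef ∨ (-S l).PosDef) →
      ((∑ k, ((X : ℝ[X]) ^ d k) • (S k).map C).det.roots.toFinset.filter (fun t => 0 < t)).card ≤ 18)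
    (hIIII : ∀ S : Fin 4 → Matrix (Fin 3) (Fin 3) ℝ, (∀ l, (S l).IsSymm) →
      (∀ l, (S l).det ≠ 0 ∧ ¬ (S l).PosDef ∧ ¬ (-S l).PosDef) →
      ((∑ k, ((X : ℝ[X]) ^ d k) • (S k).map C).det.roots.toFinset.filter (fun t => 0 < t)).card ≤ 18) :
    PosRootLawOn 3 4 18 d := by
  intro S hS
  by_cases hsing : ∃ l, (S l).det = 0
  · exact doorA34_on_singular_letter d S hS hsing
  by_cases hdef : ∃ l, (S l).PosDef ∨ (-S l).PosDef
  · exact hdefrow S hS hdef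
  push Not at hsing hdef
  exact hIIII S hS fun l => ⟨hsing l, (hdef l).1, (hdef l).2⟩

set_option maxHeartbeats 4000000 in
/-- **BOX12, sorted form, modulo the `IIII` rows**: on a sorted 3-Sidon support `0 = e₀ < e₁ < e₂ < e₃ ≤ 12`, IF every real symmetric
pencil with four nonsingular indefinite letters on each of the twelve such supports has `Z₊ ≤ 18`, then every real symmetric pencil on
`e` has `Z₊ ≤ 18` (singular sector + `lp34_box12_sorted` for the definite words). [folklore] -/
theorem box12_sorted_of_allIndefinite_rows
    (hrows : ∀ e : Fin 4 → ℕ, e ∈ ([![0, 1, 7, 11], ![0, 1, 8, 11], ![0, 3, 10, 11], ![0, 4, 10, 11], ![0, 1, 5, 12],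
        ![0, 3, 7, 12], ![0, 1, 9, 12], ![0, 2, 9, 12], ![0, 5, 9, 12], ![0, 3, 10, 12], ![0, 3, 11, 12], ![0, 7, 11, 12]] :
        List (Fin 4 → ℕ)) →
      ∀ S : Fin 4 → Matrix (Fin 3) (Fin 3) ℝ, (∀ l, (S l).IsSymm) →
        (∀ l, (S l).det ≠ 0 ∧ ¬ (S l).PosDef ∧ ¬ (-S l).PosDef) →
        ((∑ k, ((X : ℝ[X]) ^ e k) • (S k).map C).det.roots.toFinset.filter (fun t => 0 < t)).card ≤ 18)
    (e : Fin 4 → ℕ) (he : StrictMono e) (he0 : e 0 = 0) (he3 : e 3 ≤ 12)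
    (h20 : 20 ≤ ((Finset.univ : Finset (Fin 4 × Fin 4 × Fin 4)).image (fun p => e p.1 + e p.2.1 + e p.2.2)).card) :
    PosRootLawOn 3 4 18 e := by
  refine doorA34_on_of_sectors e (fun S hS hdef => lp34_box12_sorted e he he0 he3 h20 S hS hdef) fun S hS hI => ?_
  have hv : e = (![0, e 1, e 2, e 3] : Fin 4 → ℕ) := by
    funext k; fin_cases k <;> simp [he0]
  have h1 : 0 < e 1 := by have := he (show (0 : Fin 4) < 1 by decide); omega
  have h20' : 20 ≤ ((Finset.univ : Finset (Fin 4 × Fin 4 × Fin 4)).image (fun p => (![0, e 1, e 2, e 3] : Fin 4 → ℕ) p.1 +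
      (![0, e 1, e 2, e 3] : Fin 4 → ℕ) p.2.1 + (![0, e 1, e 2, e 3] : Fin 4 → ℕ) p.2.2)).card := by
    rw [← hv]; exact h20
  have hmem := sidon3_box13_enum (e 3) (List.mem_range.2 (by omega)) (e 2) (List.mem_range.2 (he (by decide)))
    (e 1) (List.mem_range.2 (he (by decide))) h1 h20'
  rw [hv]
  simp only [List.mem_cons, List.mem_nil_iff, or_false] at hmem
  rcases hmem with h | h | h | h | h | h | h | h | h | h | h | h | h | h | h | h | h | h | h | h | h | h | h | h | h | h | h | h
  · rw [h]; exact hrows _ (by simp) S hS hI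
  · rw [h]; exact hrows _ (by simp) S hS hI
  · rw [h]; exact hrows _ (by simp) S hS hI
  · rw [h]; exact hrows _ (by simp) S hS hI
  · rw [h]; exact hrows _ (by simp) S hS hI
  · rw [h]; exact hrows _ (by simp) S hS hI
  · rw [h]; exact hrows _ (by simp) S hS hI
  · rw [h]; exact hrows _ (by simp) S hS hI
  · rw [h]; exact hrows _ (by simp) S hS hI
  · rw [h]; exact hrows _ (by simp) S hS hI
  · rw [h]; exact hrows _ (by simp) S hS hI
  · rw [h]; exact hrows _ (by simp) S hS hI
  · exfalso; have h3 := congrFun h 3; simp at h3; omega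
  · exfalso; have h3 := congrFun h 3; simp at h3; omega
  · exfalso; have h3 := congrFun h 3; simp at h3; omega
  · exfalso; have h3 := congrFun h 3; simp at h3; omega
  · exfalso; have h3 := congrFun h 3; simp at h3; omega
  · exfalso; have h3 := congrFun h 3; simp at h3; omega
  · exfalso; have h3 := congrFun h 3; simp at h3; omega
  · exfalso; have h3 := congrFun h 3; simp at h3; omega
  · exfalso; have h3 := congrFun h 3; simp at h3; omega
  · exfalso; have h3 := congrFun h 3; simp at h3; omega
  · exfalso; have h3 := congrFun h 3; simp at h3; omega
  · exfalso; have h3 := congrFun h 3; simp at h3; omega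
  · exfalso; have h3 := congrFun h 3; simp at h3; omega
  · exfalso; have h3 := congrFun h 3; simp at h3; omega
  · exfalso; have h3 := congrFun h 3; simp at h3; omega
  · exfalso; have h3 := congrFun h 3; simp at h3; omega

/-- **BOX12 ⟸ THE TWELVE ALL-INDEFINITE ROWS.**  Suppose that on each of the twelve sorted 3-Sidon supports of width `≤ 12`
(`(0,1,7,11)`, `(0,1,8,11)`, `(0,3,10,11)`, `(0,4,10,11)`, `(0,1,5,12)`, `(0,3,7,12)`, `(0,1,9,12)`, `(0,2,9,12)`, `(0,5,9,12)`,
`(0,3,10,12)`, `(0,3,11,12)`, `(0,7,11,12)` — six mirror pairs) every real symmetric `3 × 3` pencil whose four letters are all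
NONSINGULAR and INDEFINITE has at most `18` distinct positive det-roots.  Then `ζ(3,4; d) ≤ 18` for EVERY exponent vector `d` with
`d i ≤ d j + 12`: the window of width `12` of `DoorA34` costs exactly these `IIII` rows (everything else — repeated or non-Sidon
exponents, a singular letter, a definite letter — is in the tree). [folklore] -/
theorem doorA34_box12_of_allIndefinite_rows
    (hrows : ∀ e : Fin 4 → ℕ, e ∈ ([![0, 1, 7, 11], ![0, 1, 8, 11], ![0, 3, 10, 11], ![0, 4, 10, 11], ![0, 1, 5, 12],
        ![0, 3, 7, 12], ![0, 1, 9, 12], ![0, 2, 9, 12], ![0, 5, 9, 12], ![0, 3, 10, 12], ![0, 3, 11, 12], ![0, 7, 11, 12]] :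
        List (Fin 4 → ℕ)) →
      ∀ S : Fin 4 → Matrix (Fin 3) (Fin 3) ℝ, (∀ l, (S l).IsSymm) →
        (∀ l, (S l).det ≠ 0 ∧ ¬ (S l).PosDef ∧ ¬ (-S l).PosDef) →
        ((∑ k, ((X : ℝ[X]) ^ e k) • (S k).map C).det.roots.toFinset.filter (fun t => 0 < t)).card ≤ 18)
    (d : Fin 4 → ℕ) (hw : ∀ i j, d i ≤ d j + 12) : PosRootLawOn 3 4 18 d :=
  doorA34_box_of_sidonRows 12 (fun e he he0 he3 h20 => box12_sorted_of_allIndefinite_rows hrows e he he0 he3 h20) d hw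

/-! ## Appendix (val-sym-door-p3 g5, same seat): the all-supports sector form of `DoorA34` -/

/-- **`DoorA34` = DEFINITE-LETTER SECTOR + ALL-INDEFINITE SECTOR on the primitive sorted 3-Sidon supports with `d₃ ≥ 11`.**
`Census.DoorA34` (`= PosRootLawAt 3 4 18`) holds iff for every primitive sorted 3-Sidon support `0 = d₀ < d₁ < d₂ < d₃`, `gcd = 1`,
`d₃ ≥ 11` (the residue list of `doorA34_iff_sidon`) BOTH rows hold: (i) every real symmetric pencil on `d` with a positive or negative
DEFINITE letter has `≤ 18` distinct positive det-roots (the sector where engine-2's LP34 certificates live), and (ii) every real symmetric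
pencil on `d` whose four letters are NONSINGULAR and INDEFINITE has `≤ 18` (the sector no instrument of the cell reaches).  The singular
sector, repeated / colliding exponents, the box `d₃ ≤ 10` and imprimitive supports are free. [folklore] -/
theorem doorA34_iff_sectors :
    DoorA34 ↔ ∀ d : Fin 4 → ℕ, StrictMono d → d 0 = 0 → Finset.univ.gcd d = 1 → 11 ≤ d 3 →
      20 ≤ ((Finset.univ : Finset (Fin 4 × Fin 4 × Fin 4)).image (fun p => d p.1 + d p.2.1 + d p.2.2)).card →
      (∀ S : Fin 4 → Matrix (Fin 3) (Fin 3) ℝ, (∀ l, (S l).IsSymm) → (∃ l, (S l).PosDef ∨ (-S l).PosDef) →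
          ((∑ k, ((X : ℝ[X]) ^ d k) • (S k).map C).det.roots.toFinset.filter (fun t => 0 < t)).card ≤ 18) ∧
        (∀ S : Fin 4 → Matrix (Fin 3) (Fin 3) ℝ, (∀ l, (S l).IsSymm) →
          (∀ l, (S l).det ≠ 0 ∧ ¬ (S l).PosDef ∧ ¬ (-S l).PosDef) →
          ((∑ k, ((X : ℝ[X]) ^ d k) • (S k).map C).det.roots.toFinset.filter (fun t => 0 < t)).card ≤ 18) := by
  rw [doorA34_iff_sidon]
  constructor
  · intro h d hd h0 hg h11 h20
    exact ⟨fun S hS _ => h d hd h0 hg h11 h20 S hS, fun S hS _ => h d hd h0 hg h11 h20 S hS⟩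
  · intro h d hd h0 hg h11 h20
    obtain ⟨hdef, hIIII⟩ := h d hd h0 hg h11 h20
    exact doorA34_on_of_sectors d hdef hIIII

end Summit.ValiantsHypothesis.ValiantsHypothesis.Theorems.LacunarySymmetroidMatrixDescartes.Census
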